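/-
Copyright (c) 2026 the pub-hodgecm-mathlib formalisation cell (harness21).  Prover seat hodgecm-mathlib-LH4-p06 (g5), Track A «(D-RAM) FOUR-FRAME», unit U2H, census leaf
(ρ2b′-X) `stub_U2H_fixedPointCensus_typeTwo_unit0` — SOCKET (C) `orderCountCensusC` (type RamM), hand (C-2TOP-odd) «TOP CELLS ON THE ODD-CLASS DIAGONAL» (LH4-p04 (g5)
SOCKET (C) LEAD LINE #6 (3)): the law of the realised off-parity rows `jλ + 1 = m + s0`.  2026-09-04.
-/
import Summits.HodgeConjecture.HodgeConjecture.Theorems.F0P3cDyRamToricLevelCensusRamMTopCellsNear   -- ★ p858164 (this seat): `topBitLit_iff_of_rel`, `normTwist_mul`; brings ★ TopCellsPrep, ★ Side, ★ LAW-i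
import Literature.NumberTheory.LocalFields.QuadraticOrderLevelClasses                            -- ★ (LH4-p08 (g4)): `exists_eq_varpi_zpow_mul_unit`
import HarnessLib

/-!
# T5c (C-2TOP-odd): the TOP-CELL LAW on the ODD-CLASS diagonal (`jλ + 1 = m + s0`) — the same census bit, by the same mechanism twisted by the odd generator

Cell `hodgecm-mathlib` (D-0151), FLOOR 0, crux H413 = `stmt-HodgeConjecture-24833`; squad F0∕P3c∕LH4; lane `--supports stmt-HodgeConjecture-24833 --as helper` (count-neutral).
THEOREMS ONLY (no `def`, no instance, no notation, no `sorry`, default heartbeats).  Socket served: LH4-p04 (g5)'s SOCKET (C), T5s-RamM EDITION 2 letter `hvTopFar` on the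
REALISED OFF-PARITY rows (★ S6b-RM `realizable_of_frame_ramM`: `jλ + 1 = m + s0`), where the diagonal `j + m = jλ + a` is the K♮-level `k = −1` line: its u-free class `η` is
ODD (`|1 + η·t(ω)| = exp(2 − 2d′)` for every unit — no translator, no anchor), and `|κ − 1| = exp(2 − 2d′)` too.  THE MECHANISM: every `x ∈ T♮ = {Θx = x, xρx = 1}` lies in the
unit shell `|x − 1| ≤ exp(−2d′)` or is `g·y` with `y` in that shell, `g := jKπ′∕ρ(jKπ′)` the odd generator (§1, Hilbert 90 on the third field + `a = π′^n·ω`); so the literal (D3)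
bit of the class `η` against `κ` is the class-T bit of ★ p857841 for the unit `κ′ := −η∕κ` (`|1 + (η∕κ)t(ω)| = |κ′·t(ω) − 1|`), ★ LAW-i (regime-free) supplies «alive ⇒ depth» and
«depth ⇒ some `x ∈ T♮` near `κ`», §1 puts `−η∕x` in the unit shell, and ★ `twist_near_or_anchored_of_thetaFixed_near`, the threshold, exclusivity and constancy of ★ p857841 run
VERBATIM on `κ′`.  RESULT (§2 **`oddBit_iff_censusBit`**): for `jλ + 1 = m + s0`, `g + s0 ≤ m + 1`, every radius letter `c = j + a − m`:
`(∃ ω₁ ∈ U_M, |1 + (η∕κ)·t(ω₁)| ≤ exp(−(2c + d_ρ))) ⟺ c + g + s0 ≤ jλ + 1 ∧ (c + 2 ≤ s0 + 2g ∨ Side_η)` — ★ p857711's `hvTop` bit again (depth `⟺ c ≤ m − g`), with the side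
letters read at the reference far cell `c″ = s0 + 2g − 1` for the class `η` and its partner `η′ = η·ψ(n₀)·t(ω_r)` (the other table's class; (C-1cls) relative letter).
HONEST LABEL.  Count-neutral (`--supports`); unconditional local algebra; nothing of (ρ2b′-X) is asserted — `HC_CM` is proved only modulo the 7 printed citations (2 remaining named
inputs: hLiu418 = `stmt-HodgeConjecture-24832`, h413 = `stmt-HodgeConjecture-24833`) until rung 0 closes.

## References
* [Serre1979] J.-P. Serre, *Local Fields*, GTM 67 (1979): Ch. V §3 Prop. 5, Cor. 3; Ch. X §1 (Hilbert 90).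
* [Kottwitz1986BaseChangeUnits] R. E. Kottwitz, *Base change for unit elements of Hecke algebras*, Compositio Math. 60 (1986): §1 pp. 240–241.
* [Jacobowitz1962] R. Jacobowitz, *Hermitian forms over local fields*, Amer. J. Math. 84 (1962): §4.
-/

set_option autoImplicit false

noncomputable section

namespace Summit.HodgeConjecture.HodgeConjecture.Cruxes.H413.F0P3cDyRamToricLevelCensusRamM

open WithZero IsLocalRing
open scoped Valued
open Literature.NumberTheory.Automorphic.UnitaryThreeFourFrame (IsRamifiedQuadraticDatum)
open Literature.NumberTheory.LocalFields.QuadraticOrder Literature.NumberTheory.LocalFields.WildQuadraticDatum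

variable {K : Type} [Field K] [Valued K ℤᵐ⁰] {ρ Θ τ : K →+* K} {α ϖE : K} {dρ t dτ tτ : ℕ}
variable {K' : Type*} [Field K'] [Valued K' ℤᵐ⁰] {σ' : K' →+* K'} {π' : K'} {d' : ℕ}

/-! ## §1 The two shells of `T♮`: the unit shell and its translate by the odd generator -/

/-- **HILBERT 90 WITH PARITY ON THE THIRD FIELD**: every `x ∈ K′` with `x·σ′x = 1` is `u∕σ′u` for a UNIT `u`, or `(π′∕σ′π′)·(u∕σ′u)` for a unit `u`
(`x = a∕σ′a` with `a = 1 + x`, resp. `a = π′ − σ′π′` if `x = −1`; `a = π′^n·ω`; `π′^{2r} = (π′σ′π′)^r·(π′∕σ′π′)^r`). [cite: Serre1979, Ch. X §1] [cite: Serre1979, Ch. V §3] -/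
theorem normOne_eq_unitQuot_or (hσ' : ∀ x, σ' (σ' x) = x) (hvσ' : ∀ x, Valued.v (σ' x) = Valued.v x)
    (hπ' : Valued.v π' = exp (-1 : ℤ)) (hdd' : Valued.v (π' - σ' π') = Valued.v π' ^ d')
    {x : K'} (hx : x * σ' x = 1) :
    ∃ u : K', Valued.v u = 1 ∧ (x = u / σ' u ∨ x = π' / σ' π' * (u / σ' u)) := by
  have hπ0 : π' ≠ 0 := fun h => by rw [h, map_zero] at hπ'; exact exp_ne_zero hπ'.symm
  have hσπ0 : σ' π' ≠ 0 := (map_ne_zero σ').2 hπ0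
  have hx0 : x ≠ 0 := fun h0 => by rw [h0, zero_mul] at hx; exact zero_ne_one hx
  -- Hilbert 90: `x = a ∕ σ′a` with `a ≠ 0`
  obtain ⟨a, ha0, hxa⟩ : ∃ a : K', a ≠ 0 ∧ x = a / σ' a := by
    by_cases hx1 : x = -1
    · refine ⟨π' - σ' π', sub_ne_zero.2 (map_varpi_ne hπ' hdd').symm, ?_⟩
      rw [map_sub, hσ', hx1, eq_div_iff (sub_ne_zero.2 (map_varpi_ne hπ' hdd')), neg_one_mul, neg_sub]
    · have h1x : 1 + x ≠ 0 := fun h => hx1 (by linear_combination h)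
      have hσx : σ' x = x⁻¹ := eq_inv_of_mul_eq_one_right hx
      have hσ1x : σ' (1 + x) ≠ 0 := fun h => h1x (by
        have h2 := congrArg σ' h; rwa [hσ', map_zero] at h2)
      refine ⟨1 + x, h1x, ?_⟩
      rw [eq_div_iff hσ1x, map_add, map_one, hσx]
      field_simp
      ring
  obtain ⟨k, ω, hω, hak⟩ := exists_eq_varpi_zpow_mul_unit hπ' ha0
  have hω0 : ω ≠ 0 := fun h0 => by rw [h0, map_zero] at hω; exact zero_ne_one hω
  have hσω0 : σ' ω ≠ 0 := (map_ne_zero σ').2 hω0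
  obtain ⟨r, hr⟩ := Int.even_or_odd' k
  -- atoms: `G = (π′∕σ′π′)^r` (with `σ′G = G⁻¹`) and `N = (π′σ′π′)^r` (`σ′`-fixed); `π′^{2r} = N·G`
  have hG1 : Valued.v ((π' / σ' π') ^ r) = 1 := by rw [map_zpow₀, map_div₀, hvσ', div_self ((Valuation.ne_zero_iff _).2 hπ0), one_zpow]
  have hG0 : (π' / σ' π') ^ r ≠ 0 := fun h0 => by rw [h0, map_zero] at hG1; exact zero_ne_one hG1
  have hσG : σ' ((π' / σ' π') ^ r) = ((π' / σ' π') ^ r)⁻¹ := by rw [map_zpow₀, map_div₀, hσ', ← inv_div, inv_zpow]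
  have hN0 : (π' * σ' π') ^ r ≠ 0 := zpow_ne_zero r (mul_ne_zero hπ0 hσπ0)
  have hσN : σ' ((π' * σ' π') ^ r) = (π' * σ' π') ^ r := by rw [map_zpow₀, map_mul, hσ', mul_comm]
  have h2r : π' ^ (2 * r) = (π' * σ' π') ^ r * (π' / σ' π') ^ r := by
    rw [← mul_zpow, show π' * σ' π' * (π' / σ' π') = π' ^ (2 : ℤ) by rw [zpow_two]; field_simp, ← zpow_mul]
  refine ⟨(π' / σ' π') ^ r * ω, by rw [map_mul, hG1, one_mul, hω], ?_⟩
  rcases hr with rfl | rfl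
  · left
    rw [hxa, hak, h2r]
    simp only [map_mul, hσN, hσG]
    field_simp
  · right
    rw [hxa, hak, zpow_add_one₀ hπ0, h2r]
    simp only [map_mul, hσN, hσG]
    field_simp

/-- **THE TWO SHELLS OF `T♮` ON `M`**: a `Θ`-fixed `x` with `x·ρx = 1` satisfies `|x − 1| ≤ exp(−2d′)`, or `x = g·y` with `g = jKπ′∕ρ(jKπ′)` and `y ∈ T♮`, `|y − 1| ≤ exp(−2d′)`.
[cite: Serre1979, Ch. X §1] [cite: Serre1979, Ch. V §3] -/
theorem thetaFixed_normOne_shell_dichotomy (hρρ : ∀ x, ρ (ρ x) = x) (hvρ : ∀ x, Valued.v (ρ x) = Valued.v x)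
    (hσ' : ∀ x, σ' (σ' x) = x) (hvσ' : ∀ x, Valued.v (σ' x) = Valued.v x)
    (hfix' : ∀ x : K', σ' x = x → x ≠ 0 → ∃ n : ℤ, Valued.v x = exp (2 * n))
    (hπ' : Valued.v π' = exp (-1 : ℤ)) (hdd' : Valued.v (π' - σ' π') = Valued.v π' ^ d')
    (jK : K' →+* K) (hjle : ∀ x y : K', Valued.v (jK x) ≤ Valued.v (jK y) ↔ Valued.v x ≤ Valued.v y) (hjΘ : ∀ x, Θ (jK x) = jK x)
    (hjfix : ∀ z : K, Θ z = z → ∃ x, jK x = z) (hjσ : ∀ x, jK (σ' x) = ρ (jK x)) (hjπ : Valued.v (jK π') = exp (-2 : ℤ))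
    {x : K} (hΘx : Θ x = x) (hx : x * ρ x = 1) :
    Valued.v (x - 1) ≤ exp (-(2 * (d' : ℤ))) ∨
      ∃ y : K, Θ y = y ∧ y * ρ y = 1 ∧ Valued.v (y - 1) ≤ exp (-(2 * (d' : ℤ))) ∧ x = jK π' / ρ (jK π') * y := by
  obtain ⟨x', rfl⟩ := hjfix x hΘx
  have hx' : x' * σ' x' = 1 := jK.injective (by rw [map_mul, hjσ, hx, map_one])
  obtain ⟨u, hu1, hcases⟩ := normOne_eq_unitQuot_or hσ' hvσ' hπ' hdd' hx'
  -- the unit quotient `y = b ∕ ρb`, `b = jK u`, lies in the unit shell of `T♮`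
  have hb1 : Valued.v (jK u) = 1 := (v_eq_one_iff_of_le_iff jK hjle u).2 hu1
  have hb0 : jK u ≠ 0 := fun h0 => by rw [h0, map_zero] at hb1; exact zero_ne_one hb1
  have hρb0 : ρ (jK u) ≠ 0 := (map_ne_zero ρ).2 hb0
  have hψ1 : Valued.v (ρ (jK u) / jK u) = 1 := by rw [map_div₀, hvρ, div_self ((Valuation.ne_zero_iff _).2 hb0)]
  have hψ := v_twist_thetaFixed_sub_one_le hσ' hfix' hπ' hdd' jK hjle hjfix hjσ hjπ (hjΘ u) hb1
  have hyeq : jK (u / σ' u) = 1 / (ρ (jK u) / jK u) := by rw [map_div₀, hjσ]; field_simp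
  have hyΘ : Θ (jK (u / σ' u)) = jK (u / σ' u) := hjΘ _
  have hyN : jK (u / σ' u) * ρ (jK (u / σ' u)) = 1 := by rw [hyeq, map_div₀, map_one, map_div₀, hρρ]; field_simp
  have hy1 : Valued.v (jK (u / σ' u) - 1) ≤ exp (-(2 * (d' : ℤ))) := by
    rw [hyeq]; exact (v_div_sub_one_le_and_mul (by rw [sub_self, map_zero]; exact zero_le) hψ hψ1).1
  rcases hcases with h | h
  · left; rw [h]; exact hy1
  · right
    refine ⟨jK (u / σ' u), hyΘ, hyN, hy1, ?_⟩
    rw [h, map_mul, map_div₀, hjσ]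

/-- In the unit shell, quotients stay: `y₁, y₂ ∈ T♮` with `|yᵢ − 1| ≤ r` give `y₁∕y₂ ∈ T♮` with `|y₁∕y₂ − 1| ≤ r`. [cite: Serre1979, Ch. V §1] -/
theorem v_div_sub_one_le_of_shell (hvρ : ∀ x, Valued.v (ρ x) = Valued.v x) {y₁ y₂ : K} {r : ℤᵐ⁰}
    (h₂ : y₂ * ρ y₂ = 1) (hy₁ : Valued.v (y₁ - 1) ≤ r) (hy₂ : Valued.v (y₂ - 1) ≤ r) : Valued.v (y₁ / y₂ - 1) ≤ r :=
  (v_div_sub_one_le_and_mul hy₁ hy₂ (v_eq_one_of_v_mul_map_eq_one hvρ (by rw [h₂]; exact Valuation.map_one _))).1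

/-! ## §2 The literal (D3) bit of a class `η` against `κ` is the class-T bit of `κ′ = −η∕κ` -/

/-- `(∃ ω₁ ∈ U_M, |1 + (η∕κ)·t(ω₁)| ≤ R) ⟺ (∃ ω ∈ U_M, |(−η∕κ)·t(ω) − 1| ≤ R)` (`(−η∕κ)t − 1 = −(1 + (η∕κ)t)`). [cite: Jacobowitz1962, §4] -/
theorem bitLit_iff_twistNear_neg {η κ : K} (R : ℤᵐ⁰) :
    (∃ ω₁ : Kˣ, Valued.v (ω₁ : K) = 1 ∧ Valued.v (1 + η / κ * (ρ ((ω₁ : K) * Θ ω₁) / ((ω₁ : K) * Θ ω₁))) ≤ R) ↔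
      ∃ ω : K, Valued.v ω = 1 ∧ Valued.v (-η / κ * (ρ (ω * Θ ω) / (ω * Θ ω)) - 1) ≤ R := by
  have key : ∀ ω : K, -η / κ * (ρ (ω * Θ ω) / (ω * Θ ω)) - 1 = -(1 + η / κ * (ρ (ω * Θ ω) / (ω * Θ ω))) := fun ω => by ring
  constructor
  · rintro ⟨ω₁, hω₁, hle⟩; exact ⟨(ω₁ : K), hω₁, by rw [key, Valuation.map_neg]; exact hle⟩
  · rintro ⟨ω, hω, hle⟩
    have hω0 : ω ≠ 0 := fun h0 => by rw [h0, map_zero] at hω; exact zero_ne_one hω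
    exact ⟨Units.mk0 ω hω0, hω, by rw [Units.val_mk0, ← Valuation.map_neg, ← key]; exact hle⟩

/-! ## §3 The top-cell law on the odd-class diagonal -/

/-- **THE TOP-CELL LAW ON THE ODD-CLASS DIAGONAL (`jλ + 1 = m + s0`).**  Frame of ★ p858107 (`ρ`-datum, `τ = Θρ`-datum, fourth-field `P, d_K`, third-field package,
`Θ`-datum, `hFN`, `n₀`, `M` complete with finite residue field; `μ = λ − u` with its tokens; dictionary `dΘ = 2g`, `dτ = 2s0`, `2d′ = d_ρ + dτ`, `2d_K = d_ρ + 2g`); the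
OFF-PARITY regime `jλ + 1 = m + s0` with `g + s0 ≤ m + 1`; a class `η ∈ T♮` in the ODD shell (`|1 + η| ≤ exp(2 − 2d′)`, `¬ |1 + η| ≤ exp(−2d′)`) and its partner
`η′ = η·ψ(n₀)·t(ω_r)`; side letters at the reference far cell `c″ = s0 + 2g − 1` (`Bit_η(c″) → SideP`, `Bit_{η′}(c″) → SideM`, `¬(SideP ∧ SideM)`).  Then for every `c`:
**`(∃ ω₁ ∈ U_M, |1 + (η∕κ)·t(ω₁)| ≤ exp(−(2c + d_ρ))) ⟺ c + g + s0 ≤ jλ + 1 ∧ (c + 2 ≤ s0 + 2g ∨ SideP)`** (`κ = ρμ∕μ`).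
[cite: Serre1979, Ch. V §3 Prop. 5, Cor. 3; Ch. X §1] [cite: Kottwitz1986BaseChangeUnits, §1 pp. 240–241] [cite: Jacobowitz1962, §4] -/
theorem oddBit_iff_censusBit [CompleteSpace K] [Finite 𝓀[K]]
    (hD : IsRamifiedQuadraticDatum ρ α dρ t) (hΘρ : ∀ x, Θ (ρ x) = ρ (Θ x)) (hvΘ : ∀ x, Valued.v (Θ x) = Valued.v x)
    (hτ : ∀ x, τ x = Θ (ρ x)) (hDτ : IsRamifiedQuadraticDatum τ α dτ tτ)
    {P : K} (hτP : τ P = P) (hP : Valued.v P = exp (-2 : ℤ)) {dK : ℕ} (hdK : Valued.v (P - ρ P) = exp (-(2 * (dK : ℤ))))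
    (hσ' : ∀ x, σ' (σ' x) = x) (hvσ' : ∀ x, Valued.v (σ' x) = Valued.v x) (hfix' : ∀ x : K', σ' x = x → x ≠ 0 → ∃ n : ℤ, Valued.v x = exp (2 * n))
    (hπ' : Valued.v π' = exp (-1 : ℤ)) (hdd' : Valued.v (π' - σ' π') = Valued.v π' ^ d')
    (jK : K' →+* K) (hjle : ∀ x y : K', Valued.v (jK x) ≤ Valued.v (jK y) ↔ Valued.v x ≤ Valued.v y) (hjΘ : ∀ x, Θ (jK x) = jK x)
    (hjfix : ∀ z : K, Θ z = z → ∃ x, jK x = z) (hjσ : ∀ x, jK (σ' x) = ρ (jK x)) (hjπ : Valued.v (jK π') = exp (-2 : ℤ))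
    {ϖ : K} {dΘ tΘ : ℕ} (hDΘ : IsRamifiedQuadraticDatum Θ ϖ dΘ tΘ)
    (hFN : ∀ f : K, ρ f = f → Θ f = f → Valued.v f = 1 → ∃ x : K, x * Θ x = f)
    {n₀ : K} (hΘn₀ : Θ n₀ = n₀) (hn₀1 : Valued.v n₀ = 1) (hn₀N : ¬ ∃ z : K, z * Θ z = n₀)
    (hϖE : Valued.v ϖE = exp (-2 : ℤ)) {lam u : K} (hlam : lam * Θ lam = 1) (hu : ρ u = u) (hu1 : u * Θ u = 1)
    {m jl : ℕ} (hμ : Valued.v (lam - u) = Valued.v ϖE ^ m) (hjl : Valued.v ((lam - u) - ρ (lam - u)) = Valued.v (ϖE ^ jl * (α - ρ α)))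
    {g s0 : ℕ} (hg : dΘ = 2 * g) (hs0 : dτ = 2 * s0) (hd' : 2 * d' = dρ + dτ) (hdK2 : 2 * dK = dρ + 2 * g)
    (hoff : jl + 1 = m + s0) (hmd : g + s0 ≤ m + 1)
    {η η' : K} (hΘη : Θ η = η) (hη1 : η * ρ η = 1)
    (hηsh : Valued.v (1 + η) ≤ exp (-(2 * (d' : ℤ) - 2))) (hodd : ¬ Valued.v (1 + η) ≤ exp (-(2 * (d' : ℤ))))
    {ω_r : Kˣ} (hω_r : Valued.v (ω_r : K) = 1) (hrel : η' = η * (ρ n₀ / n₀) * (ρ ((ω_r : K) * Θ ω_r) / ((ω_r : K) * Θ ω_r)))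
    (SideP SideM : Prop)
    (hSP : (∃ ω₁ : Kˣ, Valued.v (ω₁ : K) = 1 ∧ Valued.v (1 + η / (ρ (lam - u) / (lam - u)) * (ρ ((ω₁ : K) * Θ ω₁) / ((ω₁ : K) * Θ ω₁))) ≤
      exp (-(2 * ((s0 : ℤ) + 2 * g - 1) + dρ))) → SideP)
    (hSM : (∃ ω₁ : Kˣ, Valued.v (ω₁ : K) = 1 ∧ Valued.v (1 + η' / (ρ (lam - u) / (lam - u)) * (ρ ((ω₁ : K) * Θ ω₁) / ((ω₁ : K) * Θ ω₁))) ≤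
      exp (-(2 * ((s0 : ℤ) + 2 * g - 1) + dρ))) → SideM)
    (hPM : ¬ (SideP ∧ SideM)) (c : ℕ) :
    (∃ ω₁ : Kˣ, Valued.v (ω₁ : K) = 1 ∧ Valued.v (1 + η / (ρ (lam - u) / (lam - u)) * (ρ ((ω₁ : K) * Θ ω₁) / ((ω₁ : K) * Θ ω₁))) ≤ exp (-(2 * (c : ℤ) + dρ))) ↔
      c + g + s0 ≤ jl + 1 ∧ (c + 2 ≤ s0 + 2 * g ∨ SideP) := by
  obtain ⟨hρρ, hvρ, -, -, -, -, -⟩ := id hD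
  have hΘΘ := hDΘ.1
  have hg1 : 1 ≤ g := by have h1 := hDΘ.2.2.2.2.2.1; omega
  have hF4 := v_eq_exp_four_mul_of_fixed_fixed hτ hfix' hπ' jK hjle hjfix hjσ hjπ
  have hμ0 : lam - u ≠ 0 := fun h0 => by
    rw [h0, map_zero, v_varpiE_pow hϖE] at hμ; exact exp_ne_zero hμ.symm
  -- notation-free abbreviations
  have hκ1 : Valued.v (ρ (lam - u) / (lam - u)) = 1 := (token_twist_mu hρρ hvρ hμ0).2
  have hκ0 : ρ (lam - u) / (lam - u) ≠ 0 := fun h0 => by rw [h0, map_zero] at hκ1; exact zero_ne_one hκ1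
  have hκv : Valued.v (ρ (lam - u) / (lam - u) - 1) = exp (-(2 * (d' : ℤ) - 2)) := by
    rw [← neg_sub, Valuation.map_neg, v_one_sub_twist_eq_ramified hD hϖE hμ hjl]; congr 1; omega
  have hηv : Valued.v η = 1 := v_eq_one_of_v_mul_map_eq_one hvρ (by rw [hη1]; exact Valuation.map_one _)
  have hη0 : η ≠ 0 := fun h0 => by rw [h0, map_zero] at hηv; exact zero_ne_one hηv
  have hκ'1 : Valued.v (-η / (ρ (lam - u) / (lam - u))) = 1 := by rw [map_div₀, Valuation.map_neg, hηv, hκ1, div_one]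
  have hn₀0 : n₀ ≠ 0 := fun h0 => by rw [h0, map_zero] at hn₀1; exact zero_ne_one hn₀1
  have hρn₀0 : ρ n₀ ≠ 0 := (map_ne_zero ρ).2 hn₀0
  have hΘψ : Θ (ρ n₀ / n₀) = ρ n₀ / n₀ := by rw [map_div₀, hΘρ, hΘn₀]
  have hψN : ρ n₀ / n₀ * ρ (ρ n₀ / n₀) = 1 := by rw [map_div₀, hρρ]; field_simp
  have hΘt : ∀ ω : K, Θ (ρ (ω * Θ ω) / (ω * Θ ω)) = ρ (ω * Θ ω) / (ω * Θ ω) := fun ω => by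
    rw [map_div₀, hΘρ, map_mul Θ ω (Θ ω), hΘΘ, mul_comm (Θ ω) ω]
  have hρμ0 : ρ (lam - u) ≠ 0 := (map_ne_zero ρ).2 hμ0
  -- radii as K♮-levels
  have hRk : ∀ c' : ℕ, s0 ≤ c' → Valued.v (jK π' ^ (d' + (c' - s0))) = exp (-(2 * (c' : ℤ) + dρ)) := fun c' hc' => by
    rw [v_map_pow_eq_exp_neg_two_mul jK hjπ]; congr 1; omega
  -- the literal bits as class-T ∕ class-E bits of `κ′ = −η∕κ`
  have hconvP := fun (R : ℤᵐ⁰) => bitLit_iff_twistNear_neg (ρ := ρ) (Θ := Θ) (η := η) (κ := ρ (lam - u) / (lam - u)) R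
  have hconvM : ∀ R : ℤᵐ⁰, R < 1 →
      ((∃ ω₁ : Kˣ, Valued.v (ω₁ : K) = 1 ∧ Valued.v (1 + η' / (ρ (lam - u) / (lam - u)) * (ρ ((ω₁ : K) * Θ ω₁) / ((ω₁ : K) * Θ ω₁))) ≤ R) ↔
        ∃ ω : K, Valued.v ω = 1 ∧ Valued.v (-η / (ρ (lam - u) / (lam - u)) * (ρ n₀ / n₀) * (ρ (ω * Θ ω) / (ω * Θ ω)) - 1) ≤ R) := fun R hR => by
    rw [← topBitLit_iff_of_rel hvρ (η := η * (ρ n₀ / n₀)) (ψ := 1) (κ := ρ (lam - u) / (lam - u)) hω_r (by rw [hrel, mul_one]) hR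
      ⟨1, Valuation.map_one _, by simp⟩,
      bitLit_iff_twistNear_neg]
    refine exists_congr fun ω => and_congr_right fun _ => ?_
    rw [show -(η * (ρ n₀ / n₀)) / (ρ (lam - u) / (lam - u)) = -η / (ρ (lam - u) / (lam - u)) * (ρ n₀ / n₀) by ring]
  -- a literal bit produces an element of `T♮` near `κ`
  have hnearT : ∀ {ζ : K} {R : ℤᵐ⁰}, Θ ζ = ζ → ζ * ρ ζ = 1 →
      (∃ ω₁ : Kˣ, Valued.v (ω₁ : K) = 1 ∧ Valued.v (1 + ζ / (ρ (lam - u) / (lam - u)) * (ρ ((ω₁ : K) * Θ ω₁) / ((ω₁ : K) * Θ ω₁))) ≤ R) →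
      ∃ x : K, Θ x = x ∧ x * ρ x = 1 ∧ Valued.v (ρ (lam - u) / (lam - u) - x) ≤ R := fun {ζ R} hΘζ hζ ⟨ω₁, hω₁, hle⟩ => by
    have hω0 : (ω₁ : K) ≠ 0 := ω₁.ne_zero
    have ht := token_twist_mu hρρ hvρ (mul_ne_zero hω0 ((map_ne_zero Θ).2 hω0)) -- `t(ω₁)·ρt(ω₁) = 1`
    have hN0 : (ω₁ : K) * Θ ω₁ ≠ 0 := mul_ne_zero hω0 ((map_ne_zero Θ).2 hω0)
    have hρN0 : ρ ((ω₁ : K) * Θ ω₁) ≠ 0 := (map_ne_zero ρ).2 hN0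
    refine ⟨-ζ * (ρ ((ω₁ : K) * Θ ω₁) / ((ω₁ : K) * Θ ω₁)), by rw [map_mul, map_neg, hΘζ, hΘt], ?_, ?_⟩
    · rw [map_mul ρ (-ζ) _, map_neg, show -ζ * (ρ ((ω₁ : K) * Θ ω₁) / ((ω₁ : K) * Θ ω₁)) * (-ρ ζ * ρ (ρ ((ω₁ : K) * Θ ω₁) / ((ω₁ : K) * Θ ω₁))) =
        (ζ * ρ ζ) * (ρ ((ω₁ : K) * Θ ω₁) / ((ω₁ : K) * Θ ω₁) * ρ (ρ ((ω₁ : K) * Θ ω₁) / ((ω₁ : K) * Θ ω₁))) by ring, hζ, ht.1, one_mul]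
    · have h1 : ρ (lam - u) / (lam - u) - -ζ * (ρ ((ω₁ : K) * Θ ω₁) / ((ω₁ : K) * Θ ω₁)) =
          ρ (lam - u) / (lam - u) * (1 + ζ / (ρ (lam - u) / (lam - u)) * (ρ ((ω₁ : K) * Θ ω₁) / ((ω₁ : K) * Θ ω₁))) := by field_simp; ring
      rw [h1, Valuation.map_mul, hκ1, one_mul]; exact hle
  have hΘη' : Θ η' = η' := by
    rw [hrel, map_mul, map_mul, hΘη, hΘψ, hΘt]
  have hη'1 : η' * ρ η' = 1 := by
    have ht := token_twist_mu hρρ hvρ (mul_ne_zero ω_r.ne_zero ((map_ne_zero Θ).2 ω_r.ne_zero))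
    rw [hrel, map_mul ρ (η * (ρ n₀ / n₀)) _, map_mul ρ η (ρ n₀ / n₀), show η * (ρ n₀ / n₀) * (ρ ((ω_r : K) * Θ ω_r) / ((ω_r : K) * Θ ω_r)) *
        (ρ η * ρ (ρ n₀ / n₀) * ρ (ρ ((ω_r : K) * Θ ω_r) / ((ω_r : K) * Θ ω_r))) =
        (η * ρ η) * (ρ n₀ / n₀ * ρ (ρ n₀ / n₀)) * (ρ ((ω_r : K) * Θ ω_r) / ((ω_r : K) * Θ ω_r) * ρ (ρ ((ω_r : K) * Θ ω_r) / ((ω_r : K) * Θ ω_r))) by ring,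
      hη1, hψN, ht.1, one_mul, one_mul]
  -- ALIVE ⇒ DEPTH (`s0 ≤ c′`), either class
  have hdep : ∀ c' : ℕ, s0 ≤ c' →
      ((∃ ω₁ : Kˣ, Valued.v (ω₁ : K) = 1 ∧ Valued.v (1 + η / (ρ (lam - u) / (lam - u)) * (ρ ((ω₁ : K) * Θ ω₁) / ((ω₁ : K) * Θ ω₁))) ≤ exp (-(2 * (c' : ℤ) + dρ))) ∨
        ∃ ω₁ : Kˣ, Valued.v (ω₁ : K) = 1 ∧ Valued.v (1 + η' / (ρ (lam - u) / (lam - u)) * (ρ ((ω₁ : K) * Θ ω₁) / ((ω₁ : K) * Θ ω₁))) ≤ exp (-(2 * (c' : ℤ) + dρ))) →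
      c' + g + s0 ≤ jl + 1 := fun c' hc' h => by
    have hlaw := exists_thetaFixed_normOne_near_iff_ramified hD hΘΘ hΘρ hvΘ hτ hDτ hτP hP hdK hF4 hϖE hlam hu hu1 hjl (c := c') (by omega)
    have h1 : 2 * (c' : ℤ) + dτ + 2 * dK ≤ 2 * jl + dρ + 2 := by
      rcases h with hb | hb
      · exact hlaw.1 (hnearT hΘη hη1 hb)
      · exact hlaw.1 (hnearT hΘη' hη'1 hb)
    omega
  -- DEPTH ⇒ SOME CLASS ALIVE (`s0 ≤ c′`): LAW-i, the two shells, and the dichotomy on `κ′`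
  have halive : ∀ c' : ℕ, s0 ≤ c' → c' + g + s0 ≤ jl + 1 →
      (∃ ω : K, Valued.v ω = 1 ∧ Valued.v (-η / (ρ (lam - u) / (lam - u)) * (ρ (ω * Θ ω) / (ω * Θ ω)) - 1) ≤ exp (-(2 * (c' : ℤ) + dρ))) ∨
        ∃ ω : K, Valued.v ω = 1 ∧ Valued.v (-η / (ρ (lam - u) / (lam - u)) * (ρ n₀ / n₀) * (ρ (ω * Θ ω) / (ω * Θ ω)) - 1) ≤ exp (-(2 * (c' : ℤ) + dρ)) :=
      fun c' hc' hdp => by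
    have hlaw := exists_thetaFixed_normOne_near_iff_ramified hD hΘΘ hΘρ hvΘ hτ hDτ hτP hP hdK hF4 hϖE hlam hu hu1 hjl (c := c') (by omega)
    obtain ⟨x, hΘx, hx, hκx⟩ := hlaw.2 (by omega)
    -- `x` is in the odd shell
    obtain ⟨yx, hΘyx, hyx, hyx1, hxg⟩ : ∃ y : K, Θ y = y ∧ y * ρ y = 1 ∧ Valued.v (y - 1) ≤ exp (-(2 * (d' : ℤ))) ∧ x = jK π' / ρ (jK π') * y := by
      refine (thetaFixed_normOne_shell_dichotomy hρρ hvρ hσ' hvσ' hfix' hπ' hdd' jK hjle hjΘ hjfix hjσ hjπ hΘx hx).resolve_left fun hx1 => ?_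
      have h1 : ρ (lam - u) / (lam - u) - 1 = (ρ (lam - u) / (lam - u) - x) + (x - 1) := by ring
      have h2 := hκv.symm.trans_le ((congrArg Valued.v h1).trans_le ((Valuation.map_add _ _ _).trans (max_le (hκx.trans (by rw [exp_le_exp]; omega)) hx1)))
      rw [exp_le_exp] at h2; omega
    -- `−η` is in the odd shell
    obtain ⟨yη, hΘyη, hyη, hyη1, hηg⟩ : ∃ y : K, Θ y = y ∧ y * ρ y = 1 ∧ Valued.v (y - 1) ≤ exp (-(2 * (d' : ℤ))) ∧ -η = jK π' / ρ (jK π') * y := by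
      refine (thetaFixed_normOne_shell_dichotomy hρρ hvρ hσ' hvσ' hfix' hπ' hdd' jK hjle hjΘ hjfix hjσ hjπ (x := -η) (by rw [map_neg, hΘη])
        (by rw [map_neg, neg_mul_neg, hη1])).resolve_left fun h1 => hodd ?_
      rwa [show -η - 1 = -(1 + η) by ring, Valuation.map_neg] at h1
    have hg0 : jK π' / ρ (jK π') ≠ 0 := by
      have hp0 : jK π' ≠ 0 := fun h0 => by rw [h0, map_zero] at hjπ; exact exp_ne_zero hjπ.symm
      exact div_ne_zero hp0 ((map_ne_zero ρ).2 hp0)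
    have hyx0 : yx ≠ 0 := left_ne_zero_of_mul_eq_one hyx
    have hx0 : x ≠ 0 := by rw [hxg]; exact mul_ne_zero hg0 hyx0
    -- `z = −η∕x = yη∕yx` is in the unit shell and `R`-close to `κ′`
    have hz : -η / x = yη / yx := by rw [hηg, hxg, mul_div_mul_left _ _ hg0]
    have hΘz : Θ (yη / yx) = yη / yx := by rw [map_div₀, hΘyη, hΘyx]
    have hzN : yη / yx * ρ (yη / yx) = 1 := by
      rw [map_div₀, div_mul_div_comm, hyη, one_div, inv_eq_one]; exact hyx
    have hz1 := v_div_sub_one_le_of_shell hvρ hyx hyη1 hyx1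
    have hκ'z : Valued.v (-η / (ρ (lam - u) / (lam - u)) - yη / yx) ≤ exp (-(2 * (c' : ℤ) + dρ)) := by
      rw [← hz, show -η / (ρ (lam - u) / (lam - u)) - -η / x = -η * (x - ρ (lam - u) / (lam - u)) / (ρ (lam - u) / (lam - u) * x) by field_simp; ring,
        map_div₀, map_mul, Valuation.map_neg, hηv, one_mul, map_mul, hκ1, one_mul, ← neg_sub, Valuation.map_neg]
      rw [v_eq_one_of_v_mul_map_eq_one hvρ (show Valued.v (x * ρ x) = 1 by rw [hx]; exact Valuation.map_one _), div_one]; exact hκx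
    exact twist_near_or_anchored_of_thetaFixed_near hvρ hvΘ hσ' hvσ' hfix' hπ' hdd' jK hjle hjΘ hjfix hjσ hjπ hDΘ hΘn₀ hn₀1 hn₀N hΘz hzN hκ'z hz1
  -- THE ZONES
  have hR1 : ∀ c' : ℕ, exp (-(2 * (c' : ℤ) + dρ)) < 1 := fun c' => by rw [← exp_zero, exp_lt_exp]; have h1 := hD.2.2.2.2.2.1; omega
  by_cases hlow : c + 1 ≤ s0
  · ---------------------------------------------------------------- the low cells: `κ + η` itself is deep enough
    refine ⟨fun _ => ⟨by omega, Or.inl (by omega)⟩, fun _ => ⟨1, by rw [Units.val_one, Valuation.map_one], ?_⟩⟩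
    simp only [Units.val_one, map_one, div_one, mul_one]
    rw [show 1 + η / (ρ (lam - u) / (lam - u)) = ((ρ (lam - u) / (lam - u) - 1) + (1 + η)) / (ρ (lam - u) / (lam - u)) by
      field_simp; ring, map_div₀, hκ1, div_one]
    refine (Valuation.map_add _ _ _).trans (max_le (hκv.le.trans ?_) (hηsh.trans ?_)) <;> rw [exp_le_exp] <;> omega
  have hcs : s0 ≤ c := by omega
  by_cases hthr : c + 2 ≤ s0 + 2 * g
  · ---------------------------------------------------------------- below the threshold: both classes agree, alive iff depth
    constructor
    · intro hb; exact ⟨hdep c hcs (Or.inl hb), Or.inl hthr⟩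
    · rintro ⟨hd, -⟩
      rcases halive c hcs hd with hT | hE
      · exact (hconvP _).2 hT
      · have hbM := (hconvM _ (hR1 c)).2 hE
        have hψ : ∃ ω₂ : K, Valued.v ω₂ = 1 ∧ Valued.v (ρ n₀ / n₀ * (ρ (ω₂ * Θ ω₂) / (ω₂ * Θ ω₂)) - 1) ≤ exp (-(2 * (c : ℤ) + dρ)) := by
          rw [← hRk c hcs]
          exact (anchored_twist_near_iff_lt_threshold hvΘ hσ' hvσ' hfix' hπ' hdd' jK hjle hjΘ hjfix hjσ hjπ hDΘ hFN hΘn₀ hn₀1 hn₀N _).2 (by omega)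
        exact (topBitLit_iff_of_rel hvρ (κ := ρ (lam - u) / (lam - u)) hω_r hrel (hR1 c) hψ).2 hbM
  · ---------------------------------------------------------------- beyond the threshold: one side, the reference cell's
    by_cases hadm : 2 * s0 + 3 * g ≤ jl + 2
    · have hcs'' : s0 ≤ s0 + 2 * g - 1 := by omega
      have hR'' : exp (-(2 * ((s0 : ℤ) + 2 * g - 1) + dρ)) = exp (-(2 * ((s0 + 2 * g - 1 : ℕ) : ℤ) + dρ)) := by congr 1; omega
      constructor
      · intro hb
        refine ⟨hdep c hcs (Or.inl hb), Or.inr (hSP ?_)⟩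
        obtain ⟨ω₁, hω₁, hle⟩ := hb
        exact ⟨ω₁, hω₁, hle.trans (by rw [exp_le_exp]; omega)⟩
      · rintro ⟨hd, hside⟩
        have hS : SideP := hside.resolve_left hthr
        -- the reference cell is alive on side P
        have hTref : ∃ ω : K, Valued.v ω = 1 ∧
            Valued.v (-η / (ρ (lam - u) / (lam - u)) * (ρ (ω * Θ ω) / (ω * Θ ω)) - 1) ≤ Valued.v (jK π' ^ (d' + (s0 + 2 * g - 1 - s0))) := by
          rw [hRk _ hcs'']
          rcases halive (s0 + 2 * g - 1) hcs'' (by omega) with hT | hE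
          · exact hT
          · exfalso
            have hbM := (hconvM _ (hR1 _)).2 hE
            rw [← hR''] at hbM
            exact hPM ⟨hS, hSM hbM⟩
        have h₂ := halive c hcs hd
        rw [← hRk c hcs] at h₂
        have hT := twist_near_of_twist_near_of_near hvρ hvΘ hσ' hvσ' hfix' hπ' hdd' jK hjle hjΘ hjfix hjσ hjπ hDΘ hFN hΘn₀ hn₀1 hn₀N
          (k₁ := s0 + 2 * g - 1 - s0) (k₂ := c - s0) (by omega) (by omega) hκ'1 hTref h₂
        rw [hRk c hcs] at hT
        exact (hconvP _).2 hT
    · constructor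
      · intro hb; have h1 := hdep c hcs (Or.inl hb); omega
      · rintro ⟨hd, -⟩; omega

end Summit.HodgeConjecture.HodgeConjecture.Cruxes.H413.F0P3cDyRamToricLevelCensusRamM

end
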